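import Mathlib

/-!
# Seam-cover calculus (crux `FoolingMeasure`, stmt-PneNP-19727; round-2 ideation seat 1, gen 6)

Minimal mirror of the normal-cycle-system definitions of seat 2 (`NormalCycleSystems.lean`,
namespace `IdeasR2g3`) and seat 1 g5 (`SeamShieldCompletionEntropy.lean`, `IdeasR2g5`) — those
crux workfiles are not built modules, so the handful of definitions is repeated here verbatim.

NEW here: the HYBRID SEAM CERTIFICATE.  For two normal systems `P` (Alice) and `P'` (Bob) whose
ruler-`k` residues agree on the cut `B`, the seam colouring of `P` at a ruler-`k` position `s` whose
cycle edge lies inside `B` properly 3-colours the hybrid `aliceGraph P B ⊔ bobGraph P' B` unless `P'`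
COVERS that seam: (I) an inverted foreign step across the late set, (F) a forward own `k`-step into
the late set, (W) the `k`-wrap edge inside `B` on one side of it.  Hence two support graphs that are
compatible at `B` (both hybrids non-3-colourable) must cover each other's inside seams — a purely
order-theoretic condition on tuples of cyclic orders — and the rectangle half of X1 for measures on
normal systems reduces to the extremal statement `MutualCoverBound` typed at the end.
-/

namespace Summit.PneNP.PneNP.Cruxes.FoolingMeasure.IdeasR2g6

open Finset

/-- `t` rulers on `n = 3q+1` vertices: `P k v` is the position of vertex `v` along ruler `k`. -/
abbrev Rulers (q t : ℕ) := Fin t → Equiv.Perm (Fin (3 * q + 1))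

variable {q t : ℕ}

/-- successor of `v` along ruler `k`. -/
def succ (P : Rulers q t) (k : Fin t) (v : Fin (3 * q + 1)) : Fin (3 * q + 1) :=
  (P k).symm (P k v + 1)

/-- NORMALITY: every edge of cycle `k`, read along any other ruler `i`, jumps forward by `≡ 2 (mod 3)`. -/
def IsNormal (P : Rulers q t) : Prop :=
  ∀ i k : Fin t, i ≠ k → ∀ v, ((P i (succ P k v) - P i v).val) % 3 = 2

/-- the edge set: union of the `t` Hamiltonian cycles. -/
def edges (P : Rulers q t) : Finset (Sym2 (Fin (3 * q + 1))) :=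
  univ.biUnion fun k => univ.image fun v => s(v, succ P k v)

/-- seam colouring of ruler `σ` with seam at position `s`. -/
def seamColour {n : ℕ} [NeZero n] (σ : Equiv.Perm (Fin n)) (s : Fin n) (v : Fin n) : Fin 3 :=
  ⟨(σ v - s).val % 3, Nat.mod_lt _ (by norm_num)⟩

/-- Bob's graph of a system (edges inside `B`) and Alice's graph (edges meeting the complement). -/
def bobGraph (P : Rulers q t) (B : Finset (Fin (3 * q + 1))) : SimpleGraph (Fin (3 * q + 1)) :=
  SimpleGraph.fromEdgeSet (((edges P).filter fun e => ∀ v ∈ e, v ∈ B) : Set (Sym2 (Fin (3 * q + 1))))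

def aliceGraph (P : Rulers q t) (B : Finset (Fin (3 * q + 1))) : SimpleGraph (Fin (3 * q + 1)) :=
  SimpleGraph.fromEdgeSet (((edges P).filter fun e => ∃ v ∈ e, v ∉ B) : Set (Sym2 (Fin (3 * q + 1))))

/-! ## The cover relation (pure order combinatorics — no colouring) -/

/-- `v` is LATE for the seam at position `s` of ruler `σ` (its position is `≥ s`). -/
def Late {n : ℕ} (σ : Equiv.Perm (Fin n)) (s v : Fin n) : Prop := s.val ≤ (σ v).val

/-- the cycle-`k` edge of `P` entering position `s` lies inside `B` (an "inside seam"). -/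
def SeamInside (P : Rulers q t) (B : Finset (Fin (3 * q + 1))) (k : Fin t) (s : Fin (3 * q + 1)) :
    Prop :=
  (P k).symm (s - 1) ∈ B ∧ (P k).symm s ∈ B

/-- Bob's system `P'` COVERS the seam `(k, s)` of Alice's system `P` at the cut `B`:
(I) some foreign step of `P'` inside `B` crosses the late set of the seam INVERTED (its late endpoint
is `k`-earlier in `P'` than its early endpoint), or (F) some own `k`-step of `P'` inside `B` enters
the late set forward, or (W) the `k`-wrap step of `P'` lies inside `B` with both ends on one side. -/
def Covers (P P' : Rulers q t) (B : Finset (Fin (3 * q + 1))) (k : Fin t) (s : Fin (3 * q + 1)) :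
    Prop :=
  (∃ j, j ≠ k ∧ ∃ u, u ∈ B ∧ succ P' j u ∈ B ∧
      ((Late (P k) s u ∧ ¬ Late (P k) s (succ P' j u) ∧ (P' k u).val < (P' k (succ P' j u)).val) ∨
       (¬ Late (P k) s u ∧ Late (P k) s (succ P' j u) ∧ (P' k (succ P' j u)).val < (P' k u).val)))
  ∨ (∃ u, u ∈ B ∧ succ P' k u ∈ B ∧ (P' k u).val + 1 < 3 * q + 1 ∧
      ¬ Late (P k) s u ∧ Late (P k) s (succ P' k u))
  ∨ (∃ u, u ∈ B ∧ succ P' k u ∈ B ∧ (P' k u).val + 1 = 3 * q + 1 ∧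
      (Late (P k) s u ↔ Late (P k) s (succ P' k u)))

/-- HYBRID SEAM CERTIFICATE (first lemma of the line). -/
def SeamCoverCertificate : Prop :=
  ∀ (q t : ℕ) (P P' : Rulers q t), IsNormal P → IsNormal P' →
    ∀ (B : Finset (Fin (3 * q + 1))) (k : Fin t) (s : Fin (3 * q + 1)),
      (∀ v ∈ B, (P k v).val % 3 = (P' k v).val % 3) →   -- ruler-`k` residues agree on `B`
      SeamInside P B k s → ¬ Covers P P' B k s →
      (aliceGraph P B ⊔ bobGraph P' B).Colorable 3

/-! ## Proof of the certificate -/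

theorem val_sub_cases {n : ℕ} [NeZero n] (a b : Fin n) :
    (((a - b : Fin n) : ℕ) = a.val - b.val ∧ b.val ≤ a.val) ∨
    (((a - b : Fin n) : ℕ) = n + a.val - b.val ∧ a.val < b.val) := by
  have h := congrArg Fin.val (sub_add_cancel a b)
  rw [Fin.val_add_eq_ite] at h
  have h1 := (a - b).isLt
  have h2 := b.isLt
  split_ifs at h with hle <;> omega

/-- a seam colouring of ruler `k` of a normal system is proper on every FOREIGN edge of the SAME
system (seat 1 g5 `seamColour_foreign`, re-proved). -/
theorem seamColour_foreign (P : Rulers q t) (hP : IsNormal P) {k j : Fin t} (hkj : k ≠ j)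
    (s v : Fin (3 * q + 1)) :
    seamColour (P k) s v ≠ seamColour (P k) s (succ P j v) := by
  intro h
  have hv := congrArg Fin.val h
  simp only [seamColour] at hv
  have hn := hP k j hkj v
  have hab : P k (succ P j v) - s = (P k (succ P j v) - P k v) + (P k v - s) :=
    (sub_add_sub_cancel _ _ _).symm
  rw [hab, Fin.val_add_eq_ite] at hv
  have h1 := (P k (succ P j v) - P k v).isLt
  have h2 := (P k v - s).isLt
  split_ifs at hv <;> omega

/-- a seam colouring is proper on every edge of its OWN cycle except the seam edge
(seat 1 g5 `seamColour_own`, re-proved). -/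
theorem seamColour_own (σ : Equiv.Perm (Fin (3 * q + 1))) (s v : Fin (3 * q + 1))
    (hv : σ v + 1 ≠ s) :
    seamColour σ s v ≠ seamColour σ s (σ.symm (σ v + 1)) := by
  intro h
  have hval := congrArg Fin.val h
  simp only [seamColour, Equiv.apply_symm_apply] at hval
  have hb : σ v + 1 - s = σ v - s + 1 := (sub_add_eq_add_sub _ _ _).symm
  rw [hb, Fin.val_add_eq_ite] at hval
  rcases Nat.eq_zero_or_pos q with hq | hq
  · subst hq
    exact hv (Fin.ext (by have := (σ v + 1).isLt; have := s.isLt; omega))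
  · have h1 : ((1 : Fin (3 * q + 1)) : ℕ) = 1 := by
      rw [Fin.val_one']; exact Nat.mod_eq_of_lt (by omega)
    rw [h1] at hval
    have hx := (σ v - s).isLt
    split_ifs at hval with hle
    · apply hv
      have h0 : σ v - s + 1 = 0 := by
        apply Fin.ext
        rw [Fin.val_add_eq_ite, h1, if_pos hle, Fin.val_zero]
        omega
      rw [← hb] at h0
      exact sub_eq_zero.mp h0
    · omega

/-- Alice half: the seam colouring of `P` at an inside seam is proper on `aliceGraph P B`. -/
theorem seam_proper_alice (P : Rulers q t) (hP : IsNormal P) (B : Finset (Fin (3 * q + 1)))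
    (k : Fin t) (s : Fin (3 * q + 1)) (hs : SeamInside P B k s) :
    ∀ v w, (aliceGraph P B).Adj v w → seamColour (P k) s v ≠ seamColour (P k) s w := by
  classical
  intro v w hadj
  rw [aliceGraph, SimpleGraph.fromEdgeSet_adj] at hadj
  obtain ⟨hmem, _hne⟩ := hadj
  rw [Finset.coe_filter] at hmem
  simp only [Set.mem_setOf_eq] at hmem
  obtain ⟨hE, hout⟩ := hmem
  have core : ∀ (j : Fin t) (u : Fin (3 * q + 1)), (∃ x ∈ s(u, succ P j u), x ∉ B) →
      seamColour (P k) s u ≠ seamColour (P k) s (succ P j u) := by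
    intro j u hx
    by_cases hjk : j = k
    · rw [hjk] at hx ⊢
      show seamColour (P k) s u ≠ seamColour (P k) s ((P k).symm (P k u + 1))
      apply seamColour_own
      intro heq
      have hu : u = (P k).symm (s - 1) := by
        rw [Equiv.eq_symm_apply]; exact eq_sub_of_add_eq heq
      have hsu : succ P k u = (P k).symm s := by
        show (P k).symm (P k u + 1) = _; rw [heq]
      obtain ⟨x, hx1, hx2⟩ := hx
      apply hx2
      rcases Sym2.mem_iff.mp hx1 with h | h
      · rw [h, hu]; exact hs.1
      · rw [h, hsu]; exact hs.2
    · exact seamColour_foreign P hP (Ne.symm hjk) s u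
  simp only [edges, Finset.mem_biUnion, Finset.mem_univ, true_and, Finset.mem_image] at hE
  obtain ⟨j, u, hu⟩ := hE
  rcases Sym2.eq_iff.mp hu with ⟨rfl, rfl⟩ | ⟨rfl, rfl⟩
  · exact core j _ hout
  · exact (core j _ (by rwa [Sym2.eq_swap] at hout)).symm

/-- Bob half: the seam colouring of `P` (ruler `k`, position `s`) is proper on `bobGraph P' B`
when the ruler-`k` residues agree on `B` and `P'` does not cover the seam. -/
theorem seam_proper_bob (P P' : Rulers q t) (hP' : IsNormal P') (B : Finset (Fin (3 * q + 1)))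
    (k : Fin t) (s : Fin (3 * q + 1))
    (hres : ∀ v ∈ B, (P k v).val % 3 = (P' k v).val % 3) (hnc : ¬ Covers P P' B k s) :
    ∀ v w, (bobGraph P' B).Adj v w → seamColour (P k) s v ≠ seamColour (P k) s w := by
  classical
  intro v w hadj
  rw [bobGraph, SimpleGraph.fromEdgeSet_adj] at hadj
  obtain ⟨hmem, hne⟩ := hadj
  rw [Finset.coe_filter] at hmem
  simp only [Set.mem_setOf_eq] at hmem
  obtain ⟨hE, hin⟩ := hmem
  -- the core statement, for an oriented step `u → succ P' j u` inside `B`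
  have core : ∀ (j : Fin t) (u : Fin (3 * q + 1)), u ∈ B → succ P' j u ∈ B → u ≠ succ P' j u →
      seamColour (P k) s u ≠ seamColour (P k) s (succ P' j u) := by
    intro j u huB hwB hne hcol
    have hv := congrArg Fin.val hcol
    simp only [seamColour] at hv
    -- name the positions
    have hxu := hres u huB
    have hxw := hres _ hwB
    have hab : (P' k u).val ≠ (P' k (succ P' j u)).val := by
      intro h; exact hne ((P' k).injective (Fin.ext h))
    have bu := (P k u).isLt
    have bw := (P k (succ P' j u)).isLt
    have bu' := (P' k u).isLt
    have bw' := (P' k (succ P' j u)).isLt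
    have bs := s.isLt
    rcases val_sub_cases (P k u) s with ⟨hsu, hlu⟩ | ⟨hsu, hlu⟩ <;>
    rcases val_sub_cases (P k (succ P' j u)) s with ⟨hsw, hlw⟩ | ⟨hsw, hlw⟩
    all_goals
      rw [hsu, hsw] at hv
      by_cases hjk : j = k
      · -- own `k`-step of `P'`: position of the successor is `P' k u + 1`
        subst hjk
        have hpos : P' j (succ P' j u) = P' j u + 1 := by
          show P' j ((P' j).symm (P' j u + 1)) = _; rw [Equiv.apply_symm_apply]
        have hval1 := congrArg Fin.val hpos
        rw [Fin.val_add_eq_ite] at hval1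
        rcases Nat.eq_zero_or_pos q with hq | hq
        · subst hq; exact hne (Fin.ext (by have := u.isLt; have := (succ P' j u).isLt; omega))
        · have h1 : ((1 : Fin (3 * q + 1)) : ℕ) = 1 := by
            rw [Fin.val_one']; exact Nat.mod_eq_of_lt (by omega)
          rw [h1] at hval1
          split_ifs at hval1 with hwrap
          · -- wrap step
            first
              | omega
              | exact hnc (Or.inr (Or.inr ⟨u, huB, hwB, by omega, by unfold Late; omega⟩))
          · first
              | omega
              | exact hnc (Or.inr (Or.inl ⟨u, huB, hwB, by omega, by unfold Late; omega,
                  by unfold Late; omega⟩))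
      · -- foreign step of `P'`: normality of `P'` read along ruler `k`
        have hn := hP' k j (Ne.symm hjk) u
        rcases val_sub_cases (P' k (succ P' j u)) (P' k u) with ⟨hd, hle⟩ | ⟨hd, hlt⟩
        all_goals
          rw [hd] at hn
          first
            | omega
            | exact hnc (Or.inl ⟨j, hjk, u, huB, hwB, Or.inl ⟨by unfold Late; omega,
                by unfold Late; omega, by omega⟩⟩)
            | exact hnc (Or.inl ⟨j, hjk, u, huB, hwB, Or.inr ⟨by unfold Late; omega,
                by unfold Late; omega, by omega⟩⟩)
  simp only [edges, Finset.mem_biUnion, Finset.mem_univ, true_and, Finset.mem_image] at hE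
  obtain ⟨j, u, hu⟩ := hE
  rcases Sym2.eq_iff.mp hu with ⟨rfl, rfl⟩ | ⟨rfl, rfl⟩
  · exact core j _ (hin _ (Sym2.mem_mk_left _ _)) (hin _ (Sym2.mem_mk_right _ _)) hne
  · rw [Sym2.eq_swap] at hin
    exact (core j _ (hin _ (Sym2.mem_mk_left _ _)) (hin _ (Sym2.mem_mk_right _ _)) hne.symm).symm

/-- THE CERTIFICATE, proved. -/
theorem seamCoverCertificate_holds : SeamCoverCertificate := by
  intro q t P P' hP hP' B k s hres hs hnc
  classical
  refine ⟨SimpleGraph.Coloring.mk (seamColour (P k) s) ?_⟩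
  intro v w hadj
  rcases (SimpleGraph.sup_adj _ _ _ _).mp hadj with h | h
  · exact seam_proper_alice P hP B k s hs v w h
  · exact seam_proper_bob P P' hP' B k s hres hnc v w h

/-! ## The targets this reduces X1 to (stated, not proved) -/

/-- a family of ruler tuples is MUTUALLY COVERING at `B` when every member covers every inside seam
of every other member (the necessary condition for pairwise compatibility given by the certificate,
for members with common residues on `B`). -/
def MutuallyCovering (B : Finset (Fin (3 * q + 1))) (F : Finset (Rulers q t)) : Prop :=
  ∀ P ∈ F, ∀ P' ∈ F, P ≠ P' → ∀ (k : Fin t) (s : Fin (3 * q + 1)),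
    SeamInside P B k s → Covers P P' B k s

open Classical in
/-- number of edges of the system inside `B` (= number of inside seams, summed over rulers). -/
noncomputable def insideEdgeCount (P : Rulers q t) (B : Finset (Fin (3 * q + 1))) : ℕ :=
  ((edges P).filter fun e => ∀ v ∈ e, v ∈ B).card

/-- MUTUAL COVER BOUND (the typed crux of the line; conjectural): residue-aligned, half-dense,
mutually covering families of `t`-tuples of cyclic orders — in the FULL product space, normality is
not assumed — have at most `n^{c n}` members.  The line needs it for some `c < t - 3/2`. -/
def MutualCoverBound (t : ℕ) (γ c : ℝ) : Prop :=
  ∃ N : ℕ, ∀ q ≥ N, ∀ (B : Finset (Fin (3 * q + 1))) (F : Finset (Rulers q t)),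
    MutuallyCovering B F →
    (∀ P ∈ F, ∀ P' ∈ F, ∀ (k : Fin t), ∀ v ∈ B, (P k v).val % 3 = (P' k v).val % 3) →
    (∀ P ∈ F, (1 / 2 + γ) * (3 * q + 1 : ℝ) ≤ insideEdgeCount P B) →
    (F.card : ℝ) ≤ (3 * q + 1 : ℝ) ^ (c * (3 * q + 1))


/-! ## The adversary: pool-matched layouts cover for free (straddle lemma)

If two members pair the SAME pools `U = {u_0 < … < u_{L-1}}` (Alice's ruler order) and `W` by perfect
matchings `f, g`, then every seam of the `f`-member (between `u_i` and its partner) is straddled by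
a `g`-pair `(u_a, g u_a)` with `a ≤ i ≤ g u_a`: pigeonhole.  This is why mutual covering is FREE
inside block-run designs, so covering-type certificates alone cannot bound rectangle mass. -/

/-- STRADDLE LEMMA: a permutation of `Fin L` cannot map `{0,…,i}` into `{0,…,i-1}`. -/
theorem straddle (L : ℕ) (g : Equiv.Perm (Fin L)) (i : Fin L) : ∃ a : Fin L, a ≤ i ∧ i ≤ g a := by
  by_contra h
  push_neg at h
  -- `g` maps `Iic i` injectively into `Iio i`
  have hmaps : ∀ a ∈ Finset.Iic i, g a ∈ Finset.Iio i := by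
    intro a ha
    rw [Finset.mem_Iic] at ha
    rw [Finset.mem_Iio]
    exact h a ha
  have hcard : (Finset.Iio i).card < (Finset.Iic i).card := by
    rw [Fin.card_Iio, Fin.card_Iic]; omega
  obtain ⟨a, _, b, _, hab, hg⟩ := Finset.exists_ne_map_eq_of_card_lt_of_maps_to hcard hmaps
  exact hab (g.injective hg)


/-! ## Frame two-colourings (g6, attempt 2): `c = r_k + x`, `x : V → Bool`

The seam colourings are the special case `x = 1_{early}`.  The general two-valued FRAME colouring
of ruler `k` shifted by a Boolean function `x` is proper on the hybrid `aliceGraph P B ⊔ bobGraph P' B`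
exactly when `x` is CLOSED under four kinds of implications (forward along own `k`-steps, backward along
foreign edges — Alice's read in `P`'s ruler `k`, Bob's read in `P'`'s ruler `k`) and SPLITS every wrap
edge present.  Hence "no two-valued frame colouring in any frame" (TWO-BLOCKED) is a 2-SAT /
digraph-reachability condition, necessary for joint capturability. -/

theorem toNat_le_one (b : Bool) : b.toNat ≤ 1 := by cases b <;> simp
theorem toNat_eq_one_iff (b : Bool) : b.toNat = 1 ↔ b = true := by cases b <;> simp
theorem toNat_eq_zero_iff (b : Bool) : b.toNat = 0 ↔ b = false := by cases b <;> simp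

/-- frame colouring of ruler `σ` shifted by the Boolean function `x`. -/
def frameColour {n : ℕ} (σ : Equiv.Perm (Fin n)) (x : Fin n → Bool) (v : Fin n) : Fin 3 :=
  ⟨((σ v).val + (x v).toNat) % 3, Nat.mod_lt _ (by norm_num)⟩

/-- FRAME CLOSURE CONDITIONS of system `R`, frame ruler `k`, on the oriented steps `u → succ R j u`
selected by `sel` (Alice: steps meeting the complement of `B`; Bob: steps inside `B`):
forward along non-wrap own `k`-steps, parity on the own `k`-wrap, backward (towards the `k`-earlier
endpoint) along foreign steps. -/
def FrameClosed (R : Rulers q t) (k : Fin t) (sel : Fin (3 * q + 1) → Fin (3 * q + 1) → Prop)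
    (x : Fin (3 * q + 1) → Bool) : Prop :=
  ∀ j u, sel u (succ R j u) →
    (j = k → (R k u).val ≠ 3 * q → x u = true → x (succ R j u) = true) ∧
    (j = k → (R k u).val = 3 * q → x u ≠ x (succ R j u)) ∧
    (j ≠ k → (R k u).val < (R k (succ R j u)).val → x (succ R j u) = true → x u = true) ∧
    (j ≠ k → (R k (succ R j u)).val < (R k u).val → x u = true → x (succ R j u) = true)

/-- FRAME TWO-COLOURING CERTIFICATE (first lemma of the `frame-two-sat` line): for normal `P, P'`
with equal ruler-`k` residues on `B`, every `x` closed for Alice (in `P`) and for Bob (in `P'`)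
yields a proper 3-colouring `frameColour (P k) x` of the hybrid. -/
def FrameCertificate : Prop :=
  ∀ (q t : ℕ) (P P' : Rulers q t), IsNormal P → IsNormal P' →
  ∀ (B : Finset (Fin (3 * q + 1))) (k : Fin t) (x : Fin (3 * q + 1) → Bool),
    (∀ v ∈ B, (P k v).val % 3 = (P' k v).val % 3) →
    FrameClosed P k (fun u w => u ∉ B ∨ w ∉ B) x →
    FrameClosed P' k (fun u w => u ∈ B ∧ w ∈ B) x →
    ((aliceGraph P B) ⊔ (bobGraph P' B)).Colorable 3

/-- arithmetic core: along a step `u → succ R j u` of a normal system, equal frame colours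
(computed from any `ρ` agreeing mod 3 with the ruler-`k` positions of `R`) force one of the
four forbidden Boolean patterns. -/
theorem frame_core (R : Rulers q t) (hR : IsNormal R) (k j : Fin t) (u : Fin (3 * q + 1))
    (hne : u ≠ succ R j u) (ρ : Fin (3 * q + 1) → ℕ)
    (hρu : ρ u % 3 = (R k u).val % 3) (hρw : ρ (succ R j u) % 3 = (R k (succ R j u)).val % 3)
    (x : Fin (3 * q + 1) → Bool)
    (hcol : (ρ u + (x u).toNat) % 3 = (ρ (succ R j u) + (x (succ R j u)).toNat) % 3) :
    (j = k ∧ (R k u).val ≠ 3 * q ∧ x u = true ∧ x (succ R j u) = false) ∨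
    (j = k ∧ (R k u).val = 3 * q ∧ x u = x (succ R j u)) ∨
    (j ≠ k ∧ (R k u).val < (R k (succ R j u)).val ∧ x u = false ∧ x (succ R j u) = true) ∨
    (j ≠ k ∧ (R k (succ R j u)).val < (R k u).val ∧ x u = true ∧ x (succ R j u) = false) := by
  have tu := toNat_le_one (x u)
  have tw := toNat_le_one (x (succ R j u))
  by_cases hjk : j = k
  · subst hjk
    have hpos : R j (succ R j u) = R j u + 1 := by
      show R j ((R j).symm (R j u + 1)) = _; rw [Equiv.apply_symm_apply]
    have hval1 := congrArg Fin.val hpos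
    rw [Fin.val_add_eq_ite] at hval1
    rcases Nat.eq_zero_or_pos q with hq | hq
    · subst hq
      exact absurd (Fin.ext (by have := u.isLt; have := (succ R j u).isLt; omega)) hne
    · have h1 : ((1 : Fin (3 * q + 1)) : ℕ) = 1 := by
        rw [Fin.val_one']; exact Nat.mod_eq_of_lt (by omega)
      rw [h1] at hval1
      have bu := (R j u).isLt
      split_ifs at hval1 with hwrap
      · right; left
        refine ⟨rfl, by omega, ?_⟩
        have h2 : (x u).toNat = (x (succ R j u)).toNat := by omega
        cases hxu : x u <;> cases hxw : x (succ R j u) <;> simp_all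
      · left
        refine ⟨rfl, by omega, ?_⟩
        have h2 : (x u).toNat = 1 ∧ (x (succ R j u)).toNat = 0 := by omega
        exact ⟨(toNat_eq_one_iff _).mp h2.1, (toNat_eq_zero_iff _).mp h2.2⟩
  · have hn := hR k j (Ne.symm hjk) u
    right; right
    rcases val_sub_cases (R k (succ R j u)) (R k u) with ⟨hd, hle⟩ | ⟨hd, hlt⟩
    · rw [hd] at hn
      left
      refine ⟨hjk, by omega, ?_⟩
      have h2 : (x u).toNat = 0 ∧ (x (succ R j u)).toNat = 1 := by omega
      exact ⟨(toNat_eq_zero_iff _).mp h2.1, (toNat_eq_one_iff _).mp h2.2⟩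
    · rw [hd] at hn
      right
      refine ⟨hjk, hlt, ?_⟩
      have h2 : (x u).toNat = 1 ∧ (x (succ R j u)).toNat = 0 := by omega
      exact ⟨(toNat_eq_one_iff _).mp h2.1, (toNat_eq_zero_iff _).mp h2.2⟩

/-- from the arithmetic core and the closure conditions: colours differ along a selected step. -/
theorem frame_step (R : Rulers q t) (hR : IsNormal R) (k : Fin t)
    (sel : Fin (3 * q + 1) → Fin (3 * q + 1) → Prop) (x : Fin (3 * q + 1) → Bool)
    (hx : FrameClosed R k sel x) (ρ : Fin (3 * q + 1) → ℕ) (j : Fin t) (u : Fin (3 * q + 1))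
    (hsel : sel u (succ R j u)) (hne : u ≠ succ R j u)
    (hρu : ρ u % 3 = (R k u).val % 3) (hρw : ρ (succ R j u) % 3 = (R k (succ R j u)).val % 3) :
    (ρ u + (x u).toNat) % 3 ≠ (ρ (succ R j u) + (x (succ R j u)).toNat) % 3 := by
  intro hcol
  obtain ⟨h1, h2, h3, h4⟩ := hx j u hsel
  rcases frame_core R hR k j u hne ρ hρu hρw x hcol with
    ⟨hjk, hq, hxu, hxw⟩ | ⟨hjk, hq, hxx⟩ | ⟨hjk, hlt, hxu, hxw⟩ | ⟨hjk, hlt, hxu, hxw⟩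
  · have := h1 hjk hq hxu; rw [hxw] at this; exact Bool.false_ne_true this
  · exact h2 hjk hq hxx
  · have := h3 hjk hlt hxw; rw [hxu] at this; exact Bool.false_ne_true this
  · have := h4 hjk hlt hxu; rw [hxw] at this; exact Bool.false_ne_true this

/-- Alice half of the frame certificate. -/
theorem frame_proper_alice (P : Rulers q t) (hP : IsNormal P) (B : Finset (Fin (3 * q + 1)))
    (k : Fin t) (x : Fin (3 * q + 1) → Bool)
    (hA : FrameClosed P k (fun u w => u ∉ B ∨ w ∉ B) x) :
    ∀ v w, (aliceGraph P B).Adj v w → frameColour (P k) x v ≠ frameColour (P k) x w := by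
  classical
  intro v w hadj
  rw [aliceGraph, SimpleGraph.fromEdgeSet_adj] at hadj
  obtain ⟨hmem, hne⟩ := hadj
  rw [Finset.coe_filter] at hmem
  simp only [Set.mem_setOf_eq] at hmem
  obtain ⟨hE, hout⟩ := hmem
  have core : ∀ (j : Fin t) (u : Fin (3 * q + 1)), (∃ y ∈ s(u, succ P j u), y ∉ B) →
      u ≠ succ P j u → frameColour (P k) x u ≠ frameColour (P k) x (succ P j u) := by
    intro j u hy hne' hcol
    have hv := congrArg Fin.val hcol
    simp only [frameColour] at hv
    have hsel : u ∉ B ∨ succ P j u ∉ B := by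
      obtain ⟨y, hy1, hy2⟩ := hy
      rcases Sym2.mem_iff.mp hy1 with h | h
      · left; rwa [h] at hy2
      · right; rwa [h] at hy2
    exact frame_step P hP k _ x hA (fun v => (P k v).val) j u hsel hne' rfl rfl hv
  simp only [edges, Finset.mem_biUnion, Finset.mem_univ, true_and, Finset.mem_image] at hE
  obtain ⟨j, u, hu⟩ := hE
  rcases Sym2.eq_iff.mp hu with ⟨rfl, rfl⟩ | ⟨rfl, rfl⟩
  · exact core j _ hout hne
  · exact (core j _ (by rwa [Sym2.eq_swap] at hout) hne.symm).symm

/-- Bob half of the frame certificate. -/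
theorem frame_proper_bob (P P' : Rulers q t) (hP' : IsNormal P') (B : Finset (Fin (3 * q + 1)))
    (k : Fin t) (x : Fin (3 * q + 1) → Bool)
    (hres : ∀ v ∈ B, (P k v).val % 3 = (P' k v).val % 3)
    (hB : FrameClosed P' k (fun u w => u ∈ B ∧ w ∈ B) x) :
    ∀ v w, (bobGraph P' B).Adj v w → frameColour (P k) x v ≠ frameColour (P k) x w := by
  classical
  intro v w hadj
  rw [bobGraph, SimpleGraph.fromEdgeSet_adj] at hadj
  obtain ⟨hmem, hne⟩ := hadj
  rw [Finset.coe_filter] at hmem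
  simp only [Set.mem_setOf_eq] at hmem
  obtain ⟨hE, hin⟩ := hmem
  have core : ∀ (j : Fin t) (u : Fin (3 * q + 1)), u ∈ B → succ P' j u ∈ B → u ≠ succ P' j u →
      frameColour (P k) x u ≠ frameColour (P k) x (succ P' j u) := by
    intro j u huB hwB hne' hcol
    have hv := congrArg Fin.val hcol
    simp only [frameColour] at hv
    exact frame_step P' hP' k _ x hB (fun v => (P k v).val) j u ⟨huB, hwB⟩ hne'
      (hres u huB) (hres _ hwB) hv
  simp only [edges, Finset.mem_biUnion, Finset.mem_univ, true_and, Finset.mem_image] at hE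
  obtain ⟨j, u, hu⟩ := hE
  rcases Sym2.eq_iff.mp hu with ⟨rfl, rfl⟩ | ⟨rfl, rfl⟩
  · exact core j _ (hin _ (Sym2.mem_mk_left _ _)) (hin _ (Sym2.mem_mk_right _ _)) hne
  · rw [Sym2.eq_swap] at hin
    exact (core j _ (hin _ (Sym2.mem_mk_left _ _)) (hin _ (Sym2.mem_mk_right _ _)) hne.symm).symm

/-- THE FRAME CERTIFICATE, proved. -/
theorem frameCertificate_holds : FrameCertificate := by
  intro q t P P' hP hP' B k x hres hA hB
  classical
  refine ⟨SimpleGraph.Coloring.mk (frameColour (P k) x) ?_⟩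
  intro v w hadj
  rcases (SimpleGraph.sup_adj _ _ _ _).mp hadj with h | h
  · exact frame_proper_alice P hP B k x hA v w h
  · exact frame_proper_bob P P' hP' B k x hres hB v w h

/-- TWO-BLOCKED: Bob's system `P'` leaves NO two-valued frame colouring of Alice's system `P`
in any frame `k` (the 2-SAT condition; by `frameCertificate_holds` it is NECESSARY for the hybrid
`aliceGraph P B ⊔ bobGraph P' B` to be non-3-colourable when the residues agree on `B`). -/
def TwoBlocked (P P' : Rulers q t) (B : Finset (Fin (3 * q + 1))) : Prop :=
  ∀ (k : Fin t) (x : Fin (3 * q + 1) → Bool),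
    ¬ (FrameClosed P k (fun u w => u ∉ B ∨ w ∉ B) x ∧ FrameClosed P' k (fun u w => u ∈ B ∧ w ∈ B) x)

/-- residue alignment of two systems on `B` (all rulers). -/
def Aligned (P P' : Rulers q t) (B : Finset (Fin (3 * q + 1))) : Prop :=
  ∀ k, ∀ v ∈ B, (P k v).val % 3 = (P' k v).val % 3

theorem not_twoBlocked_colorable (P P' : Rulers q t) (hP : IsNormal P) (hP' : IsNormal P')
    (B : Finset (Fin (3 * q + 1))) (hal : Aligned P P' B) (h : ¬ TwoBlocked P P' B) :
    ((aliceGraph P B) ⊔ (bobGraph P' B)).Colorable 3 := by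
  classical
  simp only [TwoBlocked, not_forall, not_not] at h
  obtain ⟨k, x, hA, hB⟩ := h
  exact frameCertificate_holds q t P P' hP hP' B k x (hal k) hA hB

/-! ## The extremal statement this line reduces X1 (for normal-system measures) to -/

/-- Bob side (edges inside `B`) of a system. -/
def bobSide (P : Rulers q t) (B : Finset (Fin (3 * q + 1))) : Finset (Sym2 (Fin (3 * q + 1))) :=
  (edges P).filter fun e => ∀ v ∈ e, v ∈ B

/-- the Bob FIBRE of `β` inside a universe `S` of systems. -/
def bobFibre (S : Finset (Rulers q t)) (B : Finset (Fin (3 * q + 1)))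
    (β : Finset (Sym2 (Fin (3 * q + 1)))) : Finset (Rulers q t) :=
  S.filter fun P => bobSide P B = β

/-- WEAK FIBRE EXTREMALITY for two-blocking (the conjectural crux of the line; EKR-type):
inside any universe `S` of pairwise-aligned normal `t`-systems and at any near-balanced cut `B`,
a family `F ⊆ S` that is pairwise TWO-BLOCKED has at most `n^{θ n}` times the size of the largest
Bob fibre of `S` (fibres themselves are pairwise captured, so they are the trivial extremisers).
With `θ` below the half-density exponent `c_t - 1/2` this yields X1 for the uniform measure on `S`. -/
def WeakFibreExtremality (t : ℕ) (θ ε : ℝ) : Prop :=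
  ∃ n₀ : ℕ, ∀ q : ℕ, n₀ ≤ 3 * q + 1 →
  ∀ (S : Finset (Rulers q t)) (B : Finset (Fin (3 * q + 1))),
    (∀ P ∈ S, IsNormal P) → (∀ P ∈ S, ∀ P' ∈ S, Aligned P P' B) →
    (1 / 2 - ε) * (3 * q + 1 : ℝ) ≤ B.card → (B.card : ℝ) ≤ (1 / 2 + ε) * (3 * q + 1 : ℝ) →
    ∀ F ⊆ S, (∀ P ∈ F, ∀ P' ∈ F, P ≠ P' → TwoBlocked P P' B) →
      ∀ M : ℕ, (∀ β, (bobFibre S B β).card ≤ M) →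
        (F.card : ℝ) ≤ (3 * q + 1 : ℝ) ^ (θ * (3 * q + 1 : ℝ)) * M



/-! ## Corner lemma (first lemma of the `link-trie-closure` line)

If Alice's system `P` and Bob's system `P'` have the SAME SET of `B`-vertices up to (and including) a
`B`-vertex `b` in ruler `k`, `P` LINKS at `b` (its `k`-successor is inside `B`) and `P'` does NOT, then the
`P`-prefix through `b` is a frame-`k` pocket: the direction `P → P'` is not two-blocked (hence, by the frame
certificate, the hybrid is 3-colourable).  Relative order and deeper structure are irrelevant. -/

/-- same `B`-prefix sets through `b` in ruler `k`. -/
def PrefixSetAgree (P P' : Rulers q t) (B : Finset (Fin (3 * q + 1))) (k : Fin t)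
    (b : Fin (3 * q + 1)) : Prop :=
  ∀ v ∈ B, (P k v).val ≤ (P k b).val ↔ (P' k v).val ≤ (P' k b).val

def CornerLemma : Prop :=
  ∀ (q t : ℕ) (P P' : Rulers q t) (B : Finset (Fin (3 * q + 1))) (k : Fin t) (b : Fin (3 * q + 1)),
    b ∈ B → PrefixSetAgree P P' B k b → succ P k b ∈ B → succ P' k b ∉ B → (P k b).val ≠ 3 * q →
    ¬ TwoBlocked P P' B

theorem succ_pos_val (R : Rulers q t) (j : Fin t) (u : Fin (3 * q + 1)) (h : (R j u).val ≠ 3 * q) :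
    (R j (succ R j u)).val = (R j u).val + 1 := by
  have hpos : R j (succ R j u) = R j u + 1 := by
    show R j ((R j).symm (R j u + 1)) = _; rw [Equiv.apply_symm_apply]
  have hval1 := congrArg Fin.val hpos
  rw [Fin.val_add_eq_ite] at hval1
  have bu := (R j u).isLt
  rcases Nat.eq_zero_or_pos q with hq | hq
  · subst hq; omega
  · have h1 : ((1 : Fin (3 * q + 1)) : ℕ) = 1 := by
      rw [Fin.val_one']; exact Nat.mod_eq_of_lt (by omega)
    rw [h1] at hval1
    split_ifs at hval1 with hwrap
    · omega
    · exact hval1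

theorem succ_wrap_val (R : Rulers q t) (j : Fin t) (u : Fin (3 * q + 1)) (h : (R j u).val = 3 * q) :
    (R j (succ R j u)).val = 0 := by
  have hpos : R j (succ R j u) = R j u + 1 := by
    show R j ((R j).symm (R j u + 1)) = _; rw [Equiv.apply_symm_apply]
  have hval1 := congrArg Fin.val hpos
  rw [Fin.val_add_eq_ite] at hval1
  rcases Nat.eq_zero_or_pos q with hq | hq
  · subst hq; have := (R j (succ R j u)).isLt; omega
  · have h1 : ((1 : Fin (3 * q + 1)) : ℕ) = 1 := by
      rw [Fin.val_one']; exact Nat.mod_eq_of_lt (by omega)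
    rw [h1] at hval1
    split_ifs at hval1 with hwrap
    · omega
    · omega

theorem cornerLemma_holds : CornerLemma := by
  intro q t P P' B k b hb hpre hlink hnolink hnotlast hblk
  -- the pocket: indicator of the `P`-prefix through `b`
  let x : Fin (3 * q + 1) → Bool := fun v => decide ((P k v).val ≤ (P k b).val)
  have hx : ∀ v, x v = true ↔ (P k v).val ≤ (P k b).val := by
    intro v; simp [x]
  have hx' : ∀ v ∈ B, x v = true ↔ (P' k v).val ≤ (P' k b).val := by
    intro v hv; rw [hx]; exact hpre v hv
  apply hblk k x
  constructor
  · -- Alice closure in `P`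
    intro j u hsel
    refine ⟨?_, ?_, ?_, ?_⟩
    · intro hjk hnw hu
      subst hjk
      have hs := succ_pos_val P j u hnw
      rw [hx] at hu ⊢
      -- u ≠ b since the step at b is inside B
      have hub : u ≠ b := by
        rintro rfl
        rcases hsel with h | h
        · exact h hb
        · exact h hlink
      have : (P j u).val ≠ (P j b).val := fun h => hub ((P j).injective (Fin.ext h))
      omega
    · intro hjk hw
      subst hjk
      have hs := succ_wrap_val P j u hw
      intro hEq
      have h1 : x (succ P j u) = true := by rw [hx]; omega
      have h2 : x u = true := by rw [hEq]; exact h1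
      rw [hx] at h2
      have := (P j b).isLt
      omega
    · intro hjk hlt hw
      rw [hx] at hw ⊢; omega
    · intro hjk hlt hu
      rw [hx] at hu ⊢; omega
  · -- Bob closure in `P'`
    intro j u hsel
    obtain ⟨huB, hwB⟩ := hsel
    refine ⟨?_, ?_, ?_, ?_⟩
    · intro hjk hnw hu
      subst hjk
      have hs := succ_pos_val P' j u hnw
      rw [hx' u huB] at hu
      rw [hx' _ hwB]
      have hub : u ≠ b := by rintro rfl; exact hnolink hwB
      have : (P' j u).val ≠ (P' j b).val := fun h => hub ((P' j).injective (Fin.ext h))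
      omega
    · intro hjk hw
      subst hjk
      have hs := succ_wrap_val P' j u hw
      intro hEq
      have h1 : x (succ P' j u) = true := by rw [hx' _ hwB]; omega
      have h2 : x u = true := by rw [hEq]; exact h1
      rw [hx' u huB] at h2
      have hle := (P' j b).isLt
      have hub : u = b := (P' j).injective (Fin.ext (by omega))
      subst hub
      exact hnolink hwB
    · intro hjk hlt hw
      rw [hx' _ hwB] at hw; rw [hx' u huB]; omega
    · intro hjk hlt hu
      rw [hx' u huB] at hu; rw [hx' _ hwB]; omega


end Summit.PneNP.PneNP.Cruxes.FoolingMeasure.IdeasR2g6
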